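/-
Copyright (c) 2026 the pub-hodgecm-mathlib formalisation cell (harness21).  R90-TF SLAB, section S10 (Rogawski 1990, Ch. 13.8), prover R90-C138-p01 (g0):
the HEADS of the (M3) input letters (α) `AdmissibleLineTraceLetter` and (2) `PSLineTraceLetter` (★ `Theorems/R90S10M3InputLettersDefs.lean`);
h413 = `stmt-HodgeConjecture-24833`, route `HCCMUnconditional`.
-/
import Summits.HodgeConjecture.HodgeConjecture.Theorems.R90S10M3InputLettersDefs          -- ★ p863649: `AdmissibleLineTraceLetter`, `PSLineTraceLetter` (the letter TYPES)
import Summits.HodgeConjecture.HodgeConjecture.Theorems.R90S10SphericalConstituentTrace    -- ★ p863695: `admissibleLineTrace`, `smoothTrace_eq_of_isSpherical_isConstituentOf`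
import Summits.HodgeConjecture.HodgeConjecture.Theorems.F0P3XiUnramNonsplitInstance       -- ★ `isAdmissible_cmPrincipalSeries` (the Iwasawa binder discharged)
import HarnessLib

/-!
# R90-TF ∕ S10 — THE (M3) TRACE LETTERS HOLD: `admissibleLineTraceLetter_holds : AdmissibleLineTraceLetter L w KG νQw` and
# `psLineTraceLetter_holds : PSLineTraceLetter L w KG νQw` (NO finite-length input)

Cell hodgecm-mathlib, slab R90-TF, section S10 = [Rogawski1990] §13.8 (p. 219 L3), crux item h413 = `stmt-HodgeConjecture-24833`; kernel lane
`--kind proof --supports stmt-HodgeConjecture-24833 --as helper`; THEOREMS ONLY; no Lines import.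

* ★ `R90.S10.AdmissibleLineTraceLetter L w KG νQw` (`Theorems/R90S10M3InputLettersDefs.lean` §1, measure binders of RULING J-M3-1) is its body ★
  `R90.S10.admissibleLineTrace` (`Theorems/R90S10SphericalConstituentTrace.lean`) by `δ`-unfolding.
* ★ `R90.S10.PSLineTraceLetter L w KG νQw` (§2 there: the same for every realisation `I ≅ i_G(χ′) = cmPrincipalSeries L 3 w χ′` on the carrier `Gqs L w` with a `KG`-line,
  under the hyperspecial pin of J-M3-2) holds OUTRIGHT: the generic ★ `smoothTrace_eq_of_isSpherical_isConstituentOf` needs only ADMISSIBILITY of `I` — not the finite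
  length the defs file's reduction `psLineTraceLetter_of_admissibleLine` asks for — and admissibility of `i_G(χ′)` is ★ `isAdmissible_cmPrincipalSeries` (every `χ′`),
  transported to `I` along the equivalence (★ `IsAdmissible.of_surjective`).  So letter (2)'s printed input [BernsteinZelevinsky1977, §2.3] (finite length of the
  rank-one principal series) is NOT needed on this road.
p08 (g0)'s (M3) bridge consumes both BY NAME.

HONEST LABEL: helper ★s pay nothing until the consumer's edition names them and builds; HC_CM is proved only modulo the 7 printed citations (2 remaining named
inputs: hLiu418 = `stmt-HodgeConjecture-24832`, h413 = `stmt-HodgeConjecture-24833`) until rung 0 closes; REL ≠ ★ ≠ BUILT.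

## References
* [BorelJacquet1979] A. Borel, H. Jacquet, *Automorphic forms and automorphic representations*, Proc. Sympos. Pure Math. 33.1 (1979), §4.4.
* [Rogawski1990] J. Rogawski, *Automorphic Representations of Unitary Groups in Three Variables*, Ann. of Math. Stud. 123 (1990), §4.5 p. 45; §4.9 Prop. 4.9.1 (b)
  p. 55; §12.1 p. 171; §13.8 p. 219 L3.
* [BernsteinZelevinsky1976] I. N. Bernstein, A. V. Zelevinsky, Russ. Math. Surveys 31:3 (1976), §2.25 (admissibility of induced representations).
-/

set_option autoImplicit false
set_option linter.dupNamespace false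

noncomputable section

open MeasureTheory NumberField IsDedekindDomain
open Literature.NumberTheory.Rogawski1990 Literature.NumberTheory.Automorphic Literature.NumberTheory.Automorphic.UnitaryGroup
open Summit.HodgeConjecture.HodgeConjecture.Cruxes.H413.K2E1TraceFormulaBeta
open Summit.HodgeConjecture.HodgeConjecture.Cruxes.H413.F0P3XiUnramNonsplitInstance (isAdmissible_cmPrincipalSeries)

namespace Summit.HodgeConjecture.HodgeConjecture.R90.S10

/-- **THE (M3) INPUT LETTER (α) HOLDS**: `AdmissibleLineTraceLetter L w KG νQw` — every `KG`-spherical constituent of an admissible finite-length `KG`-line representation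
of `U(Φ₃)(L⁺_w)` carries its level-`KG` trace (the body is ★ `admissibleLineTrace`). [cite: BorelJacquet1979, §4.4] [cite: Rogawski1990, §4.9 Prop. 4.9.1 (b) p. 55; §13.8 p. 219 L3] -/
theorem admissibleLineTraceLetter_holds (L : Type) [Field L] [NumberField L] [IsCMField L] (w : Pl L) {_msG : MeasurableSpace (Gqs L w)} [BorelSpace (Gqs L w)]
    (KG : Subgroup (Gqs L w)) (νQw : Measure (Gqs L w)) [νQw.IsHaarMeasure] : AdmissibleLineTraceLetter L w KG νQw :=
  admissibleLineTrace L w KG νQw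

set_option maxHeartbeats 400000 in  -- the one-place model `unitaryGroupOfForm … (cmLocalForm L 3 w)` vs the CM carrier `Gqs L w` (defeq unfoldings, as ★ `K2E3CharLocIntSteinbergClasses`)
/-- **THE (M3) INPUT LETTER (2) HOLDS OUTRIGHT**: `PSLineTraceLetter L w KG νQw` — for every character `χ′` of the diagonal torus and every realisation
`I ≅ i_G(χ′) = cmPrincipalSeries L 3 w χ′` on `Gqs L w` whose `KG`-fixed space is a line, every `KG`-spherical constituent `πw` of `I` carries the level-`KG` trace of `I`.
Admissibility of `I` comes from ★ `isAdmissible_cmPrincipalSeries` along the equivalence (★ `IsAdmissible.of_surjective`); the generic ★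
`smoothTrace_eq_of_isSpherical_isConstituentOf` needs no finite length. [cite: Rogawski1990, §4.5 p. 45; §12.1 p. 171; §13.8 p. 219 L3] [cite: BernsteinZelevinsky1976, §2.25]
[cite: BorelJacquet1979, §4.4] -/
theorem psLineTraceLetter_holds (L : Type) [Field L] [NumberField L] [IsCMField L] (w : Pl L) {_msG : MeasurableSpace (Gqs L w)} [BorelSpace (Gqs L w)]
    (KG : Subgroup (Gqs L w)) (νQw : Measure (Gqs L w)) [νQw.IsHaarMeasure] : PSLineTraceLetter L w KG νQw := by
  intro _hKG χ' W _ _ I hI hline πw hsph hc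
  obtain ⟨e⟩ := hI
  have hadm : Representation.IsAdmissible (G := Gqs L w) (cmPrincipalSeries L 3 w χ') := isAdmissible_cmPrincipalSeries L w χ'
  have hIadm : I.IsAdmissible := hadm.of_surjective e.symm.toIntertwiningMap e.symm.toLinearEquiv.surjective
  exact ⟨hsph, fun φ hφ hK => smoothTrace_eq_of_isSpherical_isConstituentOf νQw hIadm hline hsph hc hφ.2 hK⟩

end Summit.HodgeConjecture.HodgeConjecture.R90.S10

end
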